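import Summits.AtomisticToContinuum.BoseEinsteinCondensation.Theorems.BECInsertionCorrectorStaticResponseBoundModulationEulerLagrange
import Summits.AtomisticToContinuum.BoseEinsteinCondensation.Theorems.BECInsertionCorrectorStaticResponseBoundEnergyFloorToPoincareFloor
import HarnessLib

/-!
# Ground-state representation of a COMPLEX state over a positive minimiser (stub `ComplexGsRep`,
# few-body layer of line `stable-fraction-square-completion`, crux
# `BECInsertionCorrector.StaticResponseBound`, item stmt-AtomisticToContinuum-12057)

For a measurable pair profile `w`, a positive real finite-energy periodic trial state `Φ` which
MINIMISES `E_w` among finite-energy periodic trial states (value `λ = E_w(Φ)`), and an arbitrary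
finite-energy periodic trial state `Ψ`, write `Ψ = (θ₁ + iθ₂)|Φ|` with the real `C¹`
lattice-periodic Bose-symmetric functions `θ₁ = Re Ψ/|Φ|`, `θ₂ = Im Ψ/|Φ|`. Then
`∫(θ₁² + θ₂²)|Φ|² = 1`, `⟨∑ⱼcos(p·xⱼ)⟩_Ψ = ∫(∑ⱼcos)(θ₁² + θ₂²)|Φ|²`, and the EXACT identity
`E_w(Ψ) = λ + 𝓔_{|Φ|}(θ₁,θ₁) + 𝓔_{|Φ|}(θ₂,θ₂)` holds
(`𝓔_F(θ,θ) = ∫|∇θ|²F² = dirichletFormW L F θ θ`).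

Proof: `|∇Ψ|² = |∇(θ₁|Φ|)|² + |∇(θ₂|Φ|)|²` and `|Ψ|² = (θ₁² + θ₂²)|Φ|²` pointwise
(`b4_kineticDensity_eq_ofReal_gradDot` of …EnergyFloorToPoincareFloor.lean), so `E_w(Ψ)` has a
real Bochner form
(`toReal_periodicEnergy_of_eq_re_im`; the interaction is a.e. finite on the cell by the finite
energy of the non-vanishing `Φ`); the `C¹` ground-state identity
`|∇(θF)|² = ∇F·∇(θ²F) + |∇θ|²F²` (`gradDot_mul_self_eq`) and the weak Euler–Lagrange equation of
the minimiser (`eulerLagrange_of_isMinimiser` with `s = 0`) tested ONCE with `ζ = θ₁² + θ₂²` give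
the identity (Davies' ground-state transform, complex test function over a real ground state).
This is the complex companion of `gsRepresentation_of_isMinimiser`
(…ModulationEulerLagrange.lean) and the `E_w`-minimiser analogue of `b4_real_gsRep`
(…EnergyFloorToPoincareFloor.lean, stated for a measurable weight and an absolute minimiser).

References: [Davies1989] §4.2 Thm 4.2.1; [ReedSimonIV1978] §XIII.1. No new definitions.
-/

noncomputable section

namespace Summit.AtomisticToContinuum.BoseEinsteinCondensation.Cruxes.StaticResponseBound.FewBody

open MeasureTheory Filter
open scoped ENNReal NNReal BigOperators Topology
open Literature.MathematicalPhysics.QuantumManyBody.BoseGas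
open Summit.AtomisticToContinuum.BoseEinsteinCondensation.Theses
open Summit.AtomisticToContinuum.BoseEinsteinCondensation.Theses.BECInsertionCorrector
open Summit.AtomisticToContinuum.BoseEinsteinCondensation.Theorems.StaticResponseBound.Negative
open Summit.AtomisticToContinuum.BoseEinsteinCondensation.Cruxes.StaticResponseBound.UvThomsonForceWave
  (contDiff_norm_of_real ae_periodicInteraction_lt_top integrableOn_toReal_interaction_mul_norm_sq
    eulerLagrange_of_isMinimiser gradDot_mul_self_eq)
open Summit.AtomisticToContinuum.BoseEinsteinCondensation.Cruxes.StaticResponseBound.StableFractionSquareCompletion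
  (b4_kineticDensity_eq_ofReal_gradDot)

variable {N : ℕ} {L : ℝ}

/-! ### The energy of `(θ₁ + iθ₂)|Φ|` in real form -/

section RealForm

variable {w : ℝ → ℝ≥0∞} {Φ : PeriodicTrialState N L}

/-- **Real form of the energy of a complex multiple of a positive state.** Let `w` be measurable,
`Φ` a real nonnegative, pointwise non-vanishing periodic trial state of finite energy, and `Ψ` a
finite-energy periodic trial state with `Ψ = (θ₁ + iθ₂)|Φ|` for real `C¹` functions `θ₁, θ₂`. Then
`E_w(Ψ) = ∫_cell (|∇(θ₁|Φ|)|² + |∇(θ₂|Φ|)|²) + ∫_cell W (θ₁² + θ₂²)|Φ|²` as real Bochner integrals,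
`W = (∑_{i<j} w^per).toReal` (the interaction is a.e. finite on the cell by the finite energy of
`Φ`, and `W|Ψ|²` is integrable by the finite energy of `Ψ`). [folklore] -/
theorem toReal_periodicEnergy_of_eq_re_im (hw : Measurable w)
    (hreal : ∀ X, Φ.ψ X = (‖Φ.ψ X‖ : ℂ)) (hpos : ∀ X, Φ.ψ X ≠ 0) (hfin : periodicEnergy w Φ ≠ ⊤)
    (Ψ : PeriodicTrialState N L) (hΨfin : periodicEnergy w Ψ ≠ ⊤) {θ₁ θ₂ : Config N → ℝ}
    (hθ₁ : ContDiff ℝ 1 θ₁) (hθ₂ : ContDiff ℝ 1 θ₂)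
    (hΨ : ∀ X, Ψ.ψ X =
      ((θ₁ X * ‖Φ.ψ X‖ : ℝ) : ℂ) + ((θ₂ X * ‖Φ.ψ X‖ : ℝ) : ℂ) * Complex.I) :
    (periodicEnergy w Ψ).toReal =
      (∫ X in cellN N L, (gradDot (fun Y => θ₁ Y * ‖Φ.ψ Y‖) (fun Y => θ₁ Y * ‖Φ.ψ Y‖) X +
          gradDot (fun Y => θ₂ Y * ‖Φ.ψ Y‖) (fun Y => θ₂ Y * ‖Φ.ψ Y‖) X)) +
        ∫ X in cellN N L,
          (periodicInteraction w L X).toReal * (θ₁ X ^ 2 + θ₂ X ^ 2) * ‖Φ.ψ X‖ ^ 2 := by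
  have hF : ContDiff ℝ 1 fun X => ‖Φ.ψ X‖ := contDiff_norm_of_real Φ hreal
  have hG₁ : ContDiff ℝ 1 fun Y => θ₁ Y * ‖Φ.ψ Y‖ := hθ₁.mul hF
  have hG₂ : ContDiff ℝ 1 fun Y => θ₂ Y * ‖Φ.ψ Y‖ := hθ₂.mul hF
  -- real and imaginary parts, modulus
  have hre : (fun Y => (Ψ.ψ Y).re) = fun Y => θ₁ Y * ‖Φ.ψ Y‖ := by
    funext Y
    rw [hΨ Y]
    simp
  have him : (fun Y => (Ψ.ψ Y).im) = fun Y => θ₂ Y * ‖Φ.ψ Y‖ := by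
    funext Y
    rw [hΨ Y]
    simp
  have hnsq : ∀ X, ‖Ψ.ψ X‖ ^ 2 = (θ₁ X ^ 2 + θ₂ X ^ 2) * ‖Φ.ψ X‖ ^ 2 := fun X => by
    rw [hΨ X, Complex.norm_add_mul_I, Real.sq_sqrt (by positivity)]
    ring
  have hnn : ∀ X, 0 ≤ (periodicInteraction w L X).toReal * (θ₁ X ^ 2 + θ₂ X ^ 2) * ‖Φ.ψ X‖ ^ 2 :=
    fun X => by positivity
  -- pointwise integrand
  have hpt : ∀ X, kineticDensity Ψ.ψ X + periodicInteraction w L X * ((‖Ψ.ψ X‖₊ : ℝ≥0∞)) ^ 2 =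
      ENNReal.ofReal (gradDot (fun Y => θ₁ Y * ‖Φ.ψ Y‖) (fun Y => θ₁ Y * ‖Φ.ψ Y‖) X +
          gradDot (fun Y => θ₂ Y * ‖Φ.ψ Y‖) (fun Y => θ₂ Y * ‖Φ.ψ Y‖) X) +
        periodicInteraction w L X * ENNReal.ofReal ((θ₁ X ^ 2 + θ₂ X ^ 2) * ‖Φ.ψ X‖ ^ 2) := by
    intro X
    rw [b4_kineticDensity_eq_ofReal_gradDot (Ψ.contDiff.differentiable one_ne_zero) X, hre,
      him, coe_nnnorm_sq_eq_ofReal, hnsq X]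
  -- integrability of the two real densities
  have hint1 : IntegrableOn (fun X =>
      gradDot (fun Y => θ₁ Y * ‖Φ.ψ Y‖) (fun Y => θ₁ Y * ‖Φ.ψ Y‖) X +
        gradDot (fun Y => θ₂ Y * ‖Φ.ψ Y‖) (fun Y => θ₂ Y * ‖Φ.ψ Y‖) X) (cellN N L) :=
    integrableOn_cellN ((continuous_gradDot hG₁ hG₁).add (continuous_gradDot hG₂ hG₂)) L
  have hint2 : IntegrableOn (fun X =>
      (periodicInteraction w L X).toReal * (θ₁ X ^ 2 + θ₂ X ^ 2) * ‖Φ.ψ X‖ ^ 2) (cellN N L) := by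
    refine (integrableOn_toReal_interaction_mul_norm_sq (Φ := Ψ) hw hΨfin).congr_fun
      (fun X _ => ?_) (measurableSet_cellN N L)
    simp only [hnsq X, mul_assoc]
  have hmeas : Measurable fun X => ENNReal.ofReal
      (gradDot (fun Y => θ₁ Y * ‖Φ.ψ Y‖) (fun Y => θ₁ Y * ‖Φ.ψ Y‖) X +
        gradDot (fun Y => θ₂ Y * ‖Φ.ψ Y‖) (fun Y => θ₂ Y * ‖Φ.ψ Y‖) X) :=
    ((continuous_gradDot hG₁ hG₁).add (continuous_gradDot hG₂ hG₂)).measurable.ennreal_ofReal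
  unfold periodicEnergy
  simp_rw [hpt]
  rw [lintegral_add_left hmeas, ← ofReal_integral_eq_lintegral_ofReal hint1 (ae_of_all _ fun X =>
      add_nonneg (gradDot_self_nonneg _ X) (gradDot_self_nonneg _ X))]
  have e2 : ∫⁻ X in cellN N L,
      periodicInteraction w L X * ENNReal.ofReal ((θ₁ X ^ 2 + θ₂ X ^ 2) * ‖Φ.ψ X‖ ^ 2) =
      ENNReal.ofReal (∫ X in cellN N L,
        (periodicInteraction w L X).toReal * (θ₁ X ^ 2 + θ₂ X ^ 2) * ‖Φ.ψ X‖ ^ 2) := by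
    rw [ofReal_integral_eq_lintegral_ofReal hint2 (ae_of_all _ hnn)]
    refine lintegral_congr_ae ?_
    filter_upwards [ae_periodicInteraction_lt_top hw hpos hfin] with X hX
    rw [mul_assoc, ENNReal.ofReal_mul ENNReal.toReal_nonneg, ENNReal.ofReal_toReal hX.ne]
  rw [e2, ← ENNReal.ofReal_add (integral_nonneg fun X =>
      add_nonneg (gradDot_self_nonneg _ X) (gradDot_self_nonneg _ X)) (integral_nonneg hnn),
    ENNReal.toReal_ofReal (add_nonneg (integral_nonneg fun X =>
      add_nonneg (gradDot_self_nonneg _ X) (gradDot_self_nonneg _ X)) (integral_nonneg hnn))]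

/-- **Ground-state representation of a complex state over a positive minimiser.** Let `w` be
measurable, `L > 0`, `Φ` a real nonnegative, pointwise non-vanishing periodic trial state of
finite energy MINIMISING `E_w` over the finite-energy periodic trial states (value `λ = E_w(Φ)`),
and `Ψ` a finite-energy periodic trial state with `Ψ = (θ₁ + iθ₂)|Φ|` for real `C¹`
lattice-periodic Bose-symmetric `θ₁, θ₂`. Then `∫(θ₁² + θ₂²)|Φ|² = 1`,
`⟨∑ⱼcos(p·xⱼ)⟩_Ψ = ∫(∑ⱼcos)(θ₁² + θ₂²)|Φ|²` for every `p = 2πk/L`, and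
`E_w(Ψ) = λ + 𝓔_{|Φ|}(θ₁,θ₁) + 𝓔_{|Φ|}(θ₂,θ₂)` (Davies' ground-state transform for `C¹` data: the
pointwise identity `|∇(θ|Φ|)|² = ∇|Φ|·∇(θ²|Φ|) + |∇θ|²|Φ|²` for `θ = θ₁, θ₂` and the weak
Euler–Lagrange equation of the minimiser tested with `ζ = θ₁² + θ₂²`).
[cite: Davies1989, §4.2 Thm 4.2.1 (proof), pp. 109–110] -/
theorem complexGsRep_of_eq (hL : 0 < L) (hw : Measurable w)
    (hreal : ∀ X, Φ.ψ X = (‖Φ.ψ X‖ : ℂ)) (hpos : ∀ X, Φ.ψ X ≠ 0) (hfin : periodicEnergy w Φ ≠ ⊤)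
    (hmin : ∀ Ψ : PeriodicTrialState N L, periodicEnergy w Ψ ≠ ⊤ →
      (periodicEnergy w Φ).toReal ≤ (periodicEnergy w Ψ).toReal)
    (Ψ : PeriodicTrialState N L) (hΨfin : periodicEnergy w Ψ ≠ ⊤) {θ₁ θ₂ : Config N → ℝ}
    (hθ₁ : ContDiff ℝ 1 θ₁) (hθ₂ : ContDiff ℝ 1 θ₂)
    (hθ₁per : IsLatticePeriodic L θ₁) (hθ₂per : IsLatticePeriodic L θ₂)
    (hθ₁symm : ∀ (σ : Equiv.Perm (Fin N)) (X : Config N), θ₁ (X ∘ σ) = θ₁ X)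
    (hθ₂symm : ∀ (σ : Equiv.Perm (Fin N)) (X : Config N), θ₂ (X ∘ σ) = θ₂ X)
    (hΨ : ∀ X, Ψ.ψ X =
      ((θ₁ X * ‖Φ.ψ X‖ : ℝ) : ℂ) + ((θ₂ X * ‖Φ.ψ X‖ : ℝ) : ℂ) * Complex.I) :
    (∫ X in cellN N L, (θ₁ X ^ 2 + θ₂ X ^ 2) * ‖Φ.ψ X‖ ^ 2) = 1 ∧
    (∀ k : Fin 3 → ℤ, cosMean L k Ψ =
      ∫ X in cellN N L, (∑ j, Real.cos (2 * Real.pi / L * ∑ i, (k i : ℝ) * X j i)) *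
        ((θ₁ X ^ 2 + θ₂ X ^ 2) * ‖Φ.ψ X‖ ^ 2)) ∧
    (periodicEnergy w Ψ).toReal = (periodicEnergy w Φ).toReal +
      dirichletFormW L (fun X => ‖Φ.ψ X‖) θ₁ θ₁ + dirichletFormW L (fun X => ‖Φ.ψ X‖) θ₂ θ₂ := by
  have hF : ContDiff ℝ 1 fun X => ‖Φ.ψ X‖ := contDiff_norm_of_real Φ hreal
  have hnsq : ∀ X, ‖Ψ.ψ X‖ ^ 2 = (θ₁ X ^ 2 + θ₂ X ^ 2) * ‖Φ.ψ X‖ ^ 2 := fun X => by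
    rw [hΨ X, Complex.norm_add_mul_I, Real.sq_sqrt (by positivity)]
    ring
  -- normalisation
  have hn : (∫ X in cellN N L, (θ₁ X ^ 2 + θ₂ X ^ 2) * ‖Φ.ψ X‖ ^ 2) = 1 := by
    rw [← integral_norm_sq_eq_one Ψ]
    exact integral_congr_ae (ae_of_all _ fun X => (hnsq X).symm)
  refine ⟨hn, fun k => ?_, ?_⟩
  · -- the density-wave mean
    unfold cosMean
    exact integral_congr_ae (ae_of_all _ fun X => by simp only [hnsq X])
  -- the Euler–Lagrange equation (`s = 0`) tested with `ζ = θ₁² + θ₂²`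
  have hζ : ContDiff ℝ 1 fun X => θ₁ X ^ 2 + θ₂ X ^ 2 := (hθ₁.pow 2).add (hθ₂.pow 2)
  have hζper : IsLatticePeriodic L fun X => θ₁ X ^ 2 + θ₂ X ^ 2 := fun X i a => by
    show θ₁ _ ^ 2 + θ₂ _ ^ 2 = θ₁ X ^ 2 + θ₂ X ^ 2
    rw [hθ₁per X i a, hθ₂per X i a]
  have hζsymm : ∀ (σ : Equiv.Perm (Fin N)) (X : Config N),
      (fun X => θ₁ X ^ 2 + θ₂ X ^ 2) (X ∘ σ) = (fun X => θ₁ X ^ 2 + θ₂ X ^ 2) X := fun σ X => by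
    simp only [hθ₁symm σ X, hθ₂symm σ X]
  have hEL := eulerLagrange_of_isMinimiser hL hw hreal hpos hfin (0 : Fin 3 → ℤ) 0
    (fun Ψ' h => by simpa only [zero_mul, add_zero] using hmin Ψ' h) hζ hζper hζsymm
  simp only [zero_mul, add_zero] at hEL
  rw [hn, mul_one] at hEL
  -- the kinetic identity, integrated
  have hkin : (∫ X in cellN N L,
      (gradDot (fun Y => θ₁ Y * ‖Φ.ψ Y‖) (fun Y => θ₁ Y * ‖Φ.ψ Y‖) X +
        gradDot (fun Y => θ₂ Y * ‖Φ.ψ Y‖) (fun Y => θ₂ Y * ‖Φ.ψ Y‖) X)) =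
      (∫ X in cellN N L,
          gradDot (fun Y => ‖Φ.ψ Y‖) (fun Y => (θ₁ Y ^ 2 + θ₂ Y ^ 2) * ‖Φ.ψ Y‖) X) +
        dirichletFormW L (fun X => ‖Φ.ψ X‖) θ₁ θ₁ +
          dirichletFormW L (fun X => ‖Φ.ψ X‖) θ₂ θ₂ := by
    have i0 : IntegrableOn (fun X =>
        gradDot (fun Y => ‖Φ.ψ Y‖) (fun Y => (θ₁ Y ^ 2 + θ₂ Y ^ 2) * ‖Φ.ψ Y‖) X) (cellN N L) :=
      integrableOn_cellN (continuous_gradDot hF (hζ.mul hF)) L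
    have i1 : IntegrableOn (fun X => gradDot θ₁ θ₁ X * ‖Φ.ψ X‖ ^ 2) (cellN N L) :=
      integrableOn_gradDot_mul_sq hF.continuous hθ₁ hθ₁ L
    have i2 : IntegrableOn (fun X => gradDot θ₂ θ₂ X * ‖Φ.ψ X‖ ^ 2) (cellN N L) :=
      integrableOn_gradDot_mul_sq hF.continuous hθ₂ hθ₂ L
    have i01 : IntegrableOn (fun X =>
        gradDot (fun Y => ‖Φ.ψ Y‖) (fun Y => (θ₁ Y ^ 2 + θ₂ Y ^ 2) * ‖Φ.ψ Y‖) X +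
          gradDot θ₁ θ₁ X * ‖Φ.ψ X‖ ^ 2) (cellN N L) := i0.add i1
    rw [dirichletFormW_def, dirichletFormW_def, ← integral_add i0 i1, ← integral_add i01 i2]
    refine integral_congr_ae (ae_of_all _ fun X => ?_)
    have hd₁ := hθ₁.differentiable one_ne_zero X
    have hd₂ := hθ₂.differentiable one_ne_zero X
    have hdF := hF.differentiable one_ne_zero X
    have hsum : (fun Y => (θ₁ Y ^ 2 + θ₂ Y ^ 2) * ‖Φ.ψ Y‖) =
        (fun Y => θ₁ Y ^ 2 * ‖Φ.ψ Y‖) + fun Y => θ₂ Y ^ 2 * ‖Φ.ψ Y‖ := by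
      funext Y
      simp only [Pi.add_apply]
      ring
    have hlin : gradDot (fun Y => ‖Φ.ψ Y‖) (fun Y => (θ₁ Y ^ 2 + θ₂ Y ^ 2) * ‖Φ.ψ Y‖) X =
        gradDot (fun Y => ‖Φ.ψ Y‖) (fun Y => θ₁ Y ^ 2 * ‖Φ.ψ Y‖) X +
          gradDot (fun Y => ‖Φ.ψ Y‖) (fun Y => θ₂ Y ^ 2 * ‖Φ.ψ Y‖) X := by
      rw [hsum, gradDot_comm (fun Y => ‖Φ.ψ Y‖)
          ((fun Y => θ₁ Y ^ 2 * ‖Φ.ψ Y‖) + fun Y => θ₂ Y ^ 2 * ‖Φ.ψ Y‖),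
        gradDot_add_left (((hθ₁.pow 2).mul hF).differentiable one_ne_zero X)
          (((hθ₂.pow 2).mul hF).differentiable one_ne_zero X),
        gradDot_comm (fun Y => θ₁ Y ^ 2 * ‖Φ.ψ Y‖), gradDot_comm (fun Y => θ₂ Y ^ 2 * ‖Φ.ψ Y‖)]
    dsimp only
    rw [gradDot_mul_self_eq hd₁ hdF, gradDot_mul_self_eq hd₂ hdF, hlin]
    ring
  rw [toReal_periodicEnergy_of_eq_re_im hw hreal hpos hfin Ψ hΨfin hθ₁ hθ₂ hΨ, hkin]
  linarith [hEL]

end RealForm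

/-! ### The registered stub -/

/-- **`ComplexGsRep` (registered stub `stub_complexGsRep` of the few-body layer, text verbatim
from the checked skeleton).** Ground-state representation of an arbitrary finite-energy periodic
trial state `Ψ` over a positive real finite-energy minimiser `Φ` of `E_w` (value `λ = E_w(Φ)`):
with `θ₁ = Re Ψ/|Φ|`, `θ₂ = Im Ψ/|Φ|` (real `C¹` lattice-periodic Bose-symmetric),
`∫(θ₁² + θ₂²)|Φ|² = 1`, `⟨∑cos⟩_Ψ = ∫(∑cos)(θ₁² + θ₂²)|Φ|²` and
`E_w(Ψ) = λ + 𝓔_{|Φ|}(θ₁,θ₁) + 𝓔_{|Φ|}(θ₂,θ₂)` (`complexGsRep_of_eq` with `Ψ = Re Ψ + i Im Ψ`).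
[cite: Davies1989, §4.2 Thm 4.2.1 (proof), pp. 109–110] -/
theorem stub_complexGsRep :
    ∀ (w : ℝ → ℝ≥0∞), Measurable w → ∀ (N : ℕ) (L : ℝ), 0 < L →
      ∀ Φ : PeriodicTrialState N L, (∀ X, Φ.ψ X = (‖Φ.ψ X‖ : ℂ)) → (∀ X, Φ.ψ X ≠ 0) →
        periodicEnergy w Φ ≠ ⊤ →
        (∀ Ψ : PeriodicTrialState N L, periodicEnergy w Ψ ≠ ⊤ →
          (periodicEnergy w Φ).toReal ≤ (periodicEnergy w Ψ).toReal) →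
        ∀ Ψ : PeriodicTrialState N L, periodicEnergy w Ψ ≠ ⊤ →
          (IsPeriodicTest L (fun X => (Ψ.ψ X).re / ‖Φ.ψ X‖) ∧
            IsPeriodicTest L (fun X => (Ψ.ψ X).im / ‖Φ.ψ X‖)) ∧
          ((∀ (σ : Equiv.Perm (Fin N)) (X : Config N),
              (fun X => (Ψ.ψ X).re / ‖Φ.ψ X‖) (X ∘ σ) = (fun X => (Ψ.ψ X).re / ‖Φ.ψ X‖) X) ∧
            (∀ (σ : Equiv.Perm (Fin N)) (X : Config N),
              (fun X => (Ψ.ψ X).im / ‖Φ.ψ X‖) (X ∘ σ) = (fun X => (Ψ.ψ X).im / ‖Φ.ψ X‖) X)) ∧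
          (∫ X in cellN N L,
              (((Ψ.ψ X).re / ‖Φ.ψ X‖) ^ 2 + ((Ψ.ψ X).im / ‖Φ.ψ X‖) ^ 2) * ‖Φ.ψ X‖ ^ 2) = 1 ∧
          (∀ k : Fin 3 → ℤ, cosMean L k Ψ =
            ∫ X in cellN N L, (∑ j, Real.cos (2 * Real.pi / L * ∑ i, (k i : ℝ) * X j i)) *
              ((((Ψ.ψ X).re / ‖Φ.ψ X‖) ^ 2 + ((Ψ.ψ X).im / ‖Φ.ψ X‖) ^ 2) * ‖Φ.ψ X‖ ^ 2)) ∧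
          (periodicEnergy w Ψ).toReal = (periodicEnergy w Φ).toReal +
            dirichletFormW L (fun X => ‖Φ.ψ X‖) (fun X => (Ψ.ψ X).re / ‖Φ.ψ X‖)
                (fun X => (Ψ.ψ X).re / ‖Φ.ψ X‖) +
              dirichletFormW L (fun X => ‖Φ.ψ X‖) (fun X => (Ψ.ψ X).im / ‖Φ.ψ X‖)
                (fun X => (Ψ.ψ X).im / ‖Φ.ψ X‖) := by
  intro w hw N L hL Φ hreal hpos hfin hmin Ψ hΨfin
  have hF : ContDiff ℝ 1 fun X => ‖Φ.ψ X‖ := contDiff_norm_of_real Φ hreal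
  have hF0 : ∀ X, ‖Φ.ψ X‖ ≠ 0 := fun X => norm_ne_zero_iff.2 (hpos X)
  -- `θ₁ = Re Ψ/|Φ|`, `θ₂ = Im Ψ/|Φ|` are real `C¹` lattice-periodic Bose-symmetric
  have hθ₁ : ContDiff ℝ 1 fun X => (Ψ.ψ X).re / ‖Φ.ψ X‖ :=
    (Complex.reCLM.contDiff.comp Ψ.contDiff).div hF hF0
  have hθ₂ : ContDiff ℝ 1 fun X => (Ψ.ψ X).im / ‖Φ.ψ X‖ :=
    (Complex.imCLM.contDiff.comp Ψ.contDiff).div hF hF0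
  have hθ₁per : IsLatticePeriodic L fun X => (Ψ.ψ X).re / ‖Φ.ψ X‖ := fun X i a => by
    simp only [Ψ.periodic X i a, Φ.periodic X i a]
  have hθ₂per : IsLatticePeriodic L fun X => (Ψ.ψ X).im / ‖Φ.ψ X‖ := fun X i a => by
    simp only [Ψ.periodic X i a, Φ.periodic X i a]
  have hθ₁symm : ∀ (σ : Equiv.Perm (Fin N)) (X : Config N),
      (fun X => (Ψ.ψ X).re / ‖Φ.ψ X‖) (X ∘ σ) = (fun X => (Ψ.ψ X).re / ‖Φ.ψ X‖) X :=
    fun σ X => by simp only [Ψ.symm σ X, Φ.symm σ X]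
  have hθ₂symm : ∀ (σ : Equiv.Perm (Fin N)) (X : Config N),
      (fun X => (Ψ.ψ X).im / ‖Φ.ψ X‖) (X ∘ σ) = (fun X => (Ψ.ψ X).im / ‖Φ.ψ X‖) X :=
    fun σ X => by simp only [Ψ.symm σ X, Φ.symm σ X]
  -- `Ψ = (θ₁ + iθ₂)|Φ|`
  have hΨ : ∀ X, Ψ.ψ X = (((Ψ.ψ X).re / ‖Φ.ψ X‖ * ‖Φ.ψ X‖ : ℝ) : ℂ) +
      (((Ψ.ψ X).im / ‖Φ.ψ X‖ * ‖Φ.ψ X‖ : ℝ) : ℂ) * Complex.I := fun X => by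
    rw [div_mul_cancel₀ _ (hF0 X), div_mul_cancel₀ _ (hF0 X), Complex.re_add_im]
  have h := complexGsRep_of_eq hL hw hreal hpos hfin hmin Ψ hΨfin hθ₁ hθ₂ hθ₁per hθ₂per
    hθ₁symm hθ₂symm hΨ
  exact ⟨⟨hθ₁per.isPeriodicTest hθ₁, hθ₂per.isPeriodicTest hθ₂⟩, ⟨hθ₁symm, hθ₂symm⟩, h⟩

end Summit.AtomisticToContinuum.BoseEinsteinCondensation.Cruxes.StaticResponseBound.FewBody

end
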